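import Mathlib
import HarnessLib
import Literature.Probability.MarkovChains.RandomTargetLemma

/-!
# Mean hitting times are the minimal non-negative solution of the first-step system (Norris, Theorem 1.3.5)

HONEST FRAMING: exact (Metropolis-corrected) sampling algorithms for lattice gauge theory; figures
of merit are autocorrelation/cost numbers at stated couplings and volumes; no continuum-physics claim.

Source: J. R. Norris, *Markov Chains*, Cambridge University Press 1997 [Norris1997], §1.3
"Hitting times and absorption probabilities", Theorem 1.3.5 with its proof (p. 17).  Everything is
PROVED (0 named facts).

SETTING.  Finite state space `X`, transition matrix `P` (`IsRowStochastic P`), target set `A ⊆ X`,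
`H^A = inf {n ≥ 0 : X_n ∈ A}`, `k_i^A = E_i(H^A) = Σ_{n<∞} n P(H^A = n) + ∞·P(H^A = ∞) ∈ [0, ∞]`.
As in the printed proof everything goes through the partial sums
`E_i(H^A ∧ n) = P_i(H^A ≥ 1) + … + P_i(H^A ≥ n)`, which satisfy (Markov property at time 1)
`E_i(H^A ∧ 0) = 0`, `E_i(H^A ∧ (n+1)) = 0` (`i ∈ A`), `= 1 + Σ_j p_ij E_j(H^A ∧ n)` (`i ∉ A`).
We DEFINE `meanHitWithin P A n i` by this recursion (a real number) and the mean hitting time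
`meanHittingTime P A i = sup_n E_i(H^A ∧ n) ∈ ℝ≥0∞` (monotone convergence; the value `∞` is
allowed, as in the source: "`k = ∞` always satisfies (1.4)"-type phenomena are exactly why
MINIMALITY is the right characterisation).

* `IsMeanHitSystemSolutionENN P A z` — the system (1.4) for `z : X → ℝ≥0∞`: `z_i = 0` (`i ∈ A`),
  `z_i = 1 + Σ_{j∉A} p_ij z_j` (`i ∉ A`) [cite: Norris1997, §1.3 Thm 1.3.5 eq. (1.4)];
  `IsMeanHitSystemSolution P A y` — the same for a real vector `y`;
* `meanHittingTime_isSolution` — `k^A` solves (1.4) [cite: Norris1997, §1.3 Thm 1.3.5 (first half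
  of the proof)];
* `IsMeanHitSystemSolutionENN.ofReal_meanHitWithin_le` — a solution `z ≥ 0` satisfies
  `E_i(H^A ∧ n) ≤ z_i` for all `n` ("`y_i ≥ P_i(H^A ≥ 1) + … + P_i(H^A ≥ n)`")
  [cite: Norris1997, §1.3, proof of Thm 1.3.5];
* **THEOREM 1.3.5** `Norris1997_thm_1_3_5` — `k^A` is the minimal non-negative solution of (1.4)
  [cite: Norris1997, §1.3 Thm 1.3.5];
* real solutions: `IsMeanHitSystemSolution.meanHitWithin_le`, `IsMeanHitSystemSolution.meanHittingTime_le`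
  — a non-negative REAL solution `y` dominates every `E_i(H^A ∧ n)`, so `k^A ≤ y < ∞`
  [cite: Norris1997, §1.3 Thm 1.3.5 (minimality)];
* `meanHittingTime_singleton_eq_ofReal` — for an IRREDUCIBLE chain and `A = {a}`: `k^{{a}}_x =
  E_x(τ_a)` is finite and equals the tree's hitting-time solution `H x a`
  (`IsHittingTimeSolution`, `RandomTargetLemma.lean`), i.e. the unique solution of the first-step
  equations IS the limit of the truncated expectations [cite: Norris1997, §1.3 Thm 1.3.5]
  [cite: LevinPeres2017, §10.2, proof of Lemma 10.1, eq. (10.3)].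

DECLARED RENDERING: `E_i(H^A ∧ n)` and `k_i^A` enter through their first-step recursion / monotone
limit, not through a measure on path space (the tree has no trajectory space); the recursion is the
content of the displayed first-step computation of the printed proof.

Context (cell pub-lqcd, venture LatticeQCDFlow): expected times to reach a target region (a
topological sector, an acceptance event) for a sampler that need NOT be irreducible on the region's
complement; the minimal-solution characterisation is what justifies computing them by solving the
linear system and discarding spurious (larger, or infinite) solutions.
-/

namespace Literature.Probability.MarkovChains

open Finset Matrix Filter Topology
open scoped ENNReal

variable {X : Type*} [Fintype X] {P : Matrix X X ℝ} {A : Set X} [DecidablePred (· ∈ A)]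

/-! ## `E_i(H^A ∧ n)` by the first-step recursion -/

/-- `meanHitWithin P A n i = E_i(H^A ∧ n) = Σ_{m=1}^{n} P_i(H^A ≥ m)`, defined by the Markov
property at time `1`: `0` for `n = 0`; for `n+1`: `0` on `A`, `1 + Σ_j p_ij E_j(H^A ∧ n)` off `A`.
[cite: Norris1997, §1.3, proof of Thm 1.3.5 (the displays `k_i^A = 1 + Σ_{j∉A} p_ij k_j^A` and
`y_i = P_i(H^A ≥ 1) + … + P_i(H^A ≥ n) + …`)] -/
def meanHitWithin (P : Matrix X X ℝ) (A : Set X) [DecidablePred (· ∈ A)] : ℕ → X → ℝ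
  | 0 => fun _ => 0
  | n + 1 => fun i => if i ∈ A then 0 else 1 + ∑ j, P i j * meanHitWithin P A n j

/-- `E_i(H^A ∧ 0) = 0`. [cite: Norris1997, §1.3 Thm 1.3.5] -/
theorem meanHitWithin_zero (i : X) : meanHitWithin P A 0 i = 0 := rfl

/-- The recursion step. [cite: Norris1997, §1.3, proof of Thm 1.3.5] -/
theorem meanHitWithin_succ (n : ℕ) (i : X) :
    meanHitWithin P A (n + 1) i =
      if i ∈ A then 0 else 1 + ∑ j, P i j * meanHitWithin P A n j := rfl

/-- On `A`: `E_i(H^A ∧ n) = 0`. [cite: Norris1997, §1.3, proof of Thm 1.3.5 ("If `X_0 = i ∈ A`,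
then `H^A = 0`, so `k_i^A = 0`")] -/
theorem meanHitWithin_of_mem {i : X} (hi : i ∈ A) (n : ℕ) : meanHitWithin P A n i = 0 := by
  cases n with
  | zero => rfl
  | succ n => simp [meanHitWithin_succ, hi]

/-- Off `A`: `E_i(H^A ∧ (n+1)) = 1 + Σ_j p_ij E_j(H^A ∧ n)`. [cite: Norris1997, §1.3, proof of
Thm 1.3.5 (Markov property at time 1)] -/
theorem meanHitWithin_succ_of_not_mem {i : X} (hi : i ∉ A) (n : ℕ) :
    meanHitWithin P A (n + 1) i = 1 + ∑ j, P i j * meanHitWithin P A n j := by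
  simp [meanHitWithin_succ, hi]

/-- The same with the sum restricted to `j ∉ A` (the terms `j ∈ A` vanish), the printed form
`1 + Σ_{j∉A} p_ij (·)_j`. [cite: Norris1997, §1.3 Thm 1.3.5 eq. (1.4)] -/
theorem meanHitWithin_succ_of_not_mem' {i : X} (hi : i ∉ A) (n : ℕ) :
    meanHitWithin P A (n + 1) i =
      1 + ∑ j, if j ∈ A then 0 else P i j * meanHitWithin P A n j := by
  rw [meanHitWithin_succ_of_not_mem hi]
  congr 1
  exact sum_congr rfl fun j _ => by
    by_cases hj : j ∈ A
    · simp [hj, meanHitWithin_of_mem hj]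
    · simp [hj]

/-- `E_i(H^A ∧ n) ≥ 0`. [cite: Norris1997, §1.3 Thm 1.3.5] -/
theorem meanHitWithin_nonneg (hP0 : ∀ x y, 0 ≤ P x y) : ∀ (n : ℕ) (i : X), 0 ≤ meanHitWithin P A n i
  | 0, i => le_rfl
  | n + 1, i => by
    rw [meanHitWithin_succ]
    split_ifs
    · exact le_rfl
    · exact add_nonneg zero_le_one
        (sum_nonneg fun j _ => mul_nonneg (hP0 i j) (meanHitWithin_nonneg hP0 n j))

/-- `E_i(H^A ∧ n) ≤ E_i(H^A ∧ (n+1))`. [cite: Norris1997, §1.3, proof of Thm 1.3.5 (the partial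
sums `P_i(H^A ≥ 1) + … + P_i(H^A ≥ n)` increase with `n`)] -/
theorem meanHitWithin_le_succ (hP0 : ∀ x y, 0 ≤ P x y) :
    ∀ (n : ℕ) (i : X), meanHitWithin P A n i ≤ meanHitWithin P A (n + 1) i
  | 0, i => by rw [meanHitWithin_zero]; exact meanHitWithin_nonneg hP0 1 i
  | n + 1, i => by
    by_cases hi : i ∈ A
    · rw [meanHitWithin_of_mem hi, meanHitWithin_of_mem hi]
    · rw [meanHitWithin_succ_of_not_mem hi, meanHitWithin_succ_of_not_mem hi]
      exact add_le_add le_rfl (sum_le_sum fun j _ =>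
        mul_le_mul_of_nonneg_left (meanHitWithin_le_succ hP0 n j) (hP0 i j))

/-- `n ↦ E_i(H^A ∧ n)` is non-decreasing. [cite: Norris1997, §1.3, proof of Thm 1.3.5] -/
theorem meanHitWithin_mono (hP0 : ∀ x y, 0 ≤ P x y) (i : X) :
    Monotone fun n => meanHitWithin P A n i :=
  monotone_nat_of_le_succ fun n => meanHitWithin_le_succ hP0 n i

/-- `E_i(H^A ∧ n) ≤ n`. [cite: Norris1997, §1.3 Thm 1.3.5] -/
theorem meanHitWithin_le (hP : IsRowStochastic P) : ∀ (n : ℕ) (i : X), meanHitWithin P A n i ≤ n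
  | 0, i => by rw [meanHitWithin_zero, Nat.cast_zero]
  | n + 1, i => by
    rw [meanHitWithin_succ]
    split_ifs
    · positivity
    · calc 1 + ∑ j, P i j * meanHitWithin P A n j ≤ 1 + ∑ j, P i j * n :=
            add_le_add le_rfl (sum_le_sum fun j _ =>
              mul_le_mul_of_nonneg_left (meanHitWithin_le hP n j) (hP.1 i j))
        _ = (n + 1 : ℕ) := by rw [← sum_mul, hP.2 i, one_mul]; push_cast; ring

/-! ## `k_i^A = E_i(H^A) ∈ [0, ∞]` -/

/-- The mean hitting time `k_i^A = E_i(H^A) = sup_n E_i(H^A ∧ n) = Σ_{n≥1} P_i(H^A ≥ n)`, an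
extended non-negative real. [cite: Norris1997, §1.3 (definition of `k_i^A`), proof of Thm 1.3.5
(last display, `Σ_{n=1}^{∞} P_i(H^A ≥ n) = E_i(H^A) = k_i^A`)] -/
noncomputable def meanHittingTime (P : Matrix X X ℝ) (A : Set X) [DecidablePred (· ∈ A)]
    (i : X) : ℝ≥0∞ :=
  ⨆ n, ENNReal.ofReal (meanHitWithin P A n i)

/-- `E_i(H^A ∧ n) ≤ k_i^A`. [cite: Norris1997, §1.3, proof of Thm 1.3.5] -/
theorem ofReal_meanHitWithin_le_meanHittingTime (n : ℕ) (i : X) :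
    ENNReal.ofReal (meanHitWithin P A n i) ≤ meanHittingTime P A i :=
  le_iSup (fun n => ENNReal.ofReal (meanHitWithin P A n i)) n

/-- The sequence `ofReal E_i(H^A ∧ n)` is monotone. [cite: Norris1997, §1.3, proof of Thm 1.3.5] -/
theorem ofReal_meanHitWithin_mono (hP0 : ∀ x y, 0 ≤ P x y) (i : X) :
    Monotone fun n => ENNReal.ofReal (meanHitWithin P A n i) :=
  fun _ _ h => ENNReal.ofReal_le_ofReal (meanHitWithin_mono hP0 i h)

/-- On `A`: `k_i^A = 0`. [cite: Norris1997, §1.3, proof of Thm 1.3.5 ("If `X_0 = i ∈ A`, then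
`H^A = 0`, so `k_i^A = 0`")] -/
theorem meanHittingTime_of_mem {i : X} (hi : i ∈ A) : meanHittingTime P A i = 0 := by
  simp [meanHittingTime, meanHitWithin_of_mem hi]

/-- The recursion step in `ℝ≥0∞`: for `i ∉ A`,
`ofReal E_i(H^A ∧ (n+1)) = 1 + Σ_{j∉A} ofReal(p_ij) · ofReal E_j(H^A ∧ n)`.
[cite: Norris1997, §1.3, proof of Thm 1.3.5] -/
theorem ofReal_meanHitWithin_succ_of_not_mem (hP0 : ∀ x y, 0 ≤ P x y) {i : X} (hi : i ∉ A)
    (n : ℕ) :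
    ENNReal.ofReal (meanHitWithin P A (n + 1) i) =
      1 + ∑ j, if j ∈ A then 0 else ENNReal.ofReal (P i j) * ENNReal.ofReal (meanHitWithin P A n j) := by
  rw [meanHitWithin_succ_of_not_mem' hi, ENNReal.ofReal_add zero_le_one
      (sum_nonneg fun j _ => by
        split_ifs
        · exact le_rfl
        · exact mul_nonneg (hP0 i j) (meanHitWithin_nonneg hP0 n j)),
    ENNReal.ofReal_one, ENNReal.ofReal_sum_of_nonneg (fun j _ => by
        split_ifs
        · exact le_rfl
        · exact mul_nonneg (hP0 i j) (meanHitWithin_nonneg hP0 n j))]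
  congr 1
  exact sum_congr rfl fun j _ => by
    split_ifs
    · exact ENNReal.ofReal_zero
    · exact ENNReal.ofReal_mul (hP0 i j)

/-- Off `A`: `k_i^A = 1 + Σ_{j∉A} p_ij k_j^A` in `[0, ∞]` (monotone convergence in the recursion).
[cite: Norris1997, §1.3, proof of Thm 1.3.5 ("First we show that `k^A` satisfies (1.4)")] -/
theorem meanHittingTime_of_not_mem (hP0 : ∀ x y, 0 ≤ P x y) {i : X} (hi : i ∉ A) :
    meanHittingTime P A i =
      1 + ∑ j, if j ∈ A then 0 else ENNReal.ofReal (P i j) * meanHittingTime P A j := by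
  have hmono := ofReal_meanHitWithin_mono (A := A) hP0
  calc meanHittingTime P A i
      = ⨆ n, ENNReal.ofReal (meanHitWithin P A (n + 1) i) := ((hmono i).iSup_nat_add 1).symm
    _ = ⨆ n, (1 + ∑ j, if j ∈ A then 0 else
          ENNReal.ofReal (P i j) * ENNReal.ofReal (meanHitWithin P A n j)) := by
        simp_rw [ofReal_meanHitWithin_succ_of_not_mem hP0 hi]
    _ = 1 + ⨆ n, ∑ j, if j ∈ A then 0 else
          ENNReal.ofReal (P i j) * ENNReal.ofReal (meanHitWithin P A n j) := by
        rw [ENNReal.add_iSup]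
    _ = 1 + ∑ j, ⨆ n, if j ∈ A then 0 else
          ENNReal.ofReal (P i j) * ENNReal.ofReal (meanHitWithin P A n j) := by
        rw [ENNReal.finsetSum_iSup_of_monotone]
        intro j
        by_cases hj : j ∈ A
        · simp only [if_pos hj]
          exact monotone_const
        · simp only [if_neg hj]
          exact fun a b h => mul_le_mul' le_rfl (hmono j h)
    _ = 1 + ∑ j, if j ∈ A then 0 else ENNReal.ofReal (P i j) * meanHittingTime P A j := by
        congr 1
        exact sum_congr rfl fun j _ => by
          by_cases hj : j ∈ A
          · simp [hj]
          · simp only [if_neg hj, meanHittingTime]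
            rw [ENNReal.mul_iSup]

/-! ## The linear system (1.4) and Theorem 1.3.5 -/

/-- The system (1.4) for an extended-real vector `z : X → [0, ∞]`: `z_i = 0` for `i ∈ A`,
`z_i = 1 + Σ_{j∉A} p_ij z_j` for `i ∉ A`. [cite: Norris1997, §1.3 Thm 1.3.5 eq. (1.4)] -/
def IsMeanHitSystemSolutionENN (P : Matrix X X ℝ) (A : Set X) [DecidablePred (· ∈ A)]
    (z : X → ℝ≥0∞) : Prop :=
  (∀ i, i ∈ A → z i = 0) ∧
    ∀ i, i ∉ A → z i = 1 + ∑ j, if j ∈ A then 0 else ENNReal.ofReal (P i j) * z j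

/-- The system (1.4) for a real vector `y : X → ℝ`: `y_i = 0` for `i ∈ A`,
`y_i = 1 + Σ_{j∉A} p_ij y_j` for `i ∉ A`. [cite: Norris1997, §1.3 Thm 1.3.5 eq. (1.4)] -/
def IsMeanHitSystemSolution (P : Matrix X X ℝ) (A : Set X) [DecidablePred (· ∈ A)]
    (y : X → ℝ) : Prop :=
  (∀ i, i ∈ A → y i = 0) ∧ ∀ i, i ∉ A → y i = 1 + ∑ j, if j ∈ A then 0 else P i j * y j

/-- `k^A` satisfies (1.4). [cite: Norris1997, §1.3 Thm 1.3.5 (first half of the proof)] -/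
theorem meanHittingTime_isSolution (hP0 : ∀ x y, 0 ≤ P x y) :
    IsMeanHitSystemSolutionENN P A (meanHittingTime P A) :=
  ⟨fun _ hi => meanHittingTime_of_mem hi, fun _ hi => meanHittingTime_of_not_mem hP0 hi⟩

/-- For a solution `z` of (1.4) in `[0, ∞]`: `E_i(H^A ∧ n) ≤ z_i` for every `n` ("so, if `y` is
non-negative, `y_i ≥ P_i(H^A ≥ 1) + … + P_i(H^A ≥ n)`"). [cite: Norris1997, §1.3, proof of
Thm 1.3.5] -/
theorem IsMeanHitSystemSolutionENN.ofReal_meanHitWithin_le (hP0 : ∀ x y, 0 ≤ P x y)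
    {z : X → ℝ≥0∞} (hz : IsMeanHitSystemSolutionENN P A z) :
    ∀ (n : ℕ) (i : X), ENNReal.ofReal (meanHitWithin P A n i) ≤ z i
  | 0, i => by rw [meanHitWithin_zero, ENNReal.ofReal_zero]; exact bot_le
  | n + 1, i => by
    by_cases hi : i ∈ A
    · rw [meanHitWithin_of_mem hi, ENNReal.ofReal_zero]
      exact bot_le
    · rw [ofReal_meanHitWithin_succ_of_not_mem hP0 hi, hz.2 i hi]
      refine add_le_add le_rfl (sum_le_sum fun j _ => ?_)
      by_cases hj : j ∈ A
      · simp [hj]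
      · simp only [if_neg hj]
        exact mul_le_mul' le_rfl (IsMeanHitSystemSolutionENN.ofReal_meanHitWithin_le hP0 hz n j)

/-- Minimality in `[0, ∞]`: every solution `z` of (1.4) dominates `k^A`. [cite: Norris1997, §1.3
Thm 1.3.5 ("letting `n → ∞`, `y_i ≥ Σ_{n=1}^{∞} P_i(H^A ≥ n) = E_i(H^A) = k_i^A`")] -/
theorem IsMeanHitSystemSolutionENN.meanHittingTime_le (hP0 : ∀ x y, 0 ≤ P x y) {z : X → ℝ≥0∞}
    (hz : IsMeanHitSystemSolutionENN P A z) (i : X) : meanHittingTime P A i ≤ z i :=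
  iSup_le fun n => hz.ofReal_meanHitWithin_le hP0 n i

/-- **THEOREM 1.3.5 (Norris).**  The vector of mean hitting times `k^A = (k_i^A : i ∈ I)` is the
minimal non-negative solution to the system of linear equations (1.4): `k_i^A = 0` for `i ∈ A`,
`k_i^A = 1 + Σ_{j∉A} p_ij k_j^A` for `i ∉ A` — it is a solution (with values in `[0, ∞]`), and
every solution `z ≥ 0` satisfies `z_i ≥ k_i^A` for all `i`. [cite: Norris1997, §1.3 Thm 1.3.5] -/
theorem Norris1997_thm_1_3_5 (hP0 : ∀ x y, 0 ≤ P x y) :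
    IsMeanHitSystemSolutionENN P A (meanHittingTime P A) ∧
      ∀ z : X → ℝ≥0∞, IsMeanHitSystemSolutionENN P A z → ∀ i, meanHittingTime P A i ≤ z i :=
  ⟨meanHittingTime_isSolution hP0, fun _ hz => hz.meanHittingTime_le hP0⟩

/-! ## Real (finite) solutions -/

/-- For a non-negative REAL solution `y` of (1.4): `E_i(H^A ∧ n) ≤ y_i` for every `n`.
[cite: Norris1997, §1.3, proof of Thm 1.3.5] -/
theorem IsMeanHitSystemSolution.meanHitWithin_le (hP0 : ∀ x y, 0 ≤ P x y) {y : X → ℝ}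
    (hy : IsMeanHitSystemSolution P A y) (hy0 : ∀ i, 0 ≤ y i) :
    ∀ (n : ℕ) (i : X), meanHitWithin P A n i ≤ y i
  | 0, i => by rw [meanHitWithin_zero]; exact hy0 i
  | n + 1, i => by
    by_cases hi : i ∈ A
    · rw [meanHitWithin_of_mem hi, hy.1 i hi]
    · rw [meanHitWithin_succ_of_not_mem' hi, hy.2 i hi]
      refine add_le_add le_rfl (sum_le_sum fun j _ => ?_)
      by_cases hj : j ∈ A
      · simp [hj]
      · simp only [if_neg hj]
        exact mul_le_mul_of_nonneg_left
          (IsMeanHitSystemSolution.meanHitWithin_le hP0 hy hy0 n j) (hP0 i j)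

/-- A non-negative real solution is a solution in `[0, ∞]` (via `ofReal`). [cite: Norris1997, §1.3
Thm 1.3.5 eq. (1.4)] -/
theorem IsMeanHitSystemSolution.toENN (hP0 : ∀ x y, 0 ≤ P x y) {y : X → ℝ}
    (hy : IsMeanHitSystemSolution P A y) (hy0 : ∀ i, 0 ≤ y i) :
    IsMeanHitSystemSolutionENN P A (fun i => ENNReal.ofReal (y i)) := by
  refine ⟨fun i hi => by show ENNReal.ofReal (y i) = 0; rw [hy.1 i hi, ENNReal.ofReal_zero],
    fun i hi => ?_⟩
  show ENNReal.ofReal (y i) =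
    1 + ∑ j, (if j ∈ A then 0 else ENNReal.ofReal (P i j) * ENNReal.ofReal (y j))
  have hnn : ∀ j, 0 ≤ (if j ∈ A then 0 else P i j * y j) := fun j => by
    split_ifs
    · exact le_rfl
    · exact mul_nonneg (hP0 i j) (hy0 j)
  rw [hy.2 i hi, ENNReal.ofReal_add zero_le_one (sum_nonneg fun j _ => hnn j), ENNReal.ofReal_one,
    ENNReal.ofReal_sum_of_nonneg fun j _ => hnn j]
  congr 1
  exact sum_congr rfl fun j _ => by
    split_ifs
    · exact ENNReal.ofReal_zero
    · exact ENNReal.ofReal_mul (hP0 i j)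

/-- Hence a non-negative real solution `y` bounds the mean hitting times: `k_i^A ≤ y_i`; in
particular `k^A` is finite as soon as (1.4) has a non-negative real solution. [cite: Norris1997,
§1.3 Thm 1.3.5 (minimality)] -/
theorem IsMeanHitSystemSolution.meanHittingTime_le (hP0 : ∀ x y, 0 ≤ P x y) {y : X → ℝ}
    (hy : IsMeanHitSystemSolution P A y) (hy0 : ∀ i, 0 ≤ y i) (i : X) :
    meanHittingTime P A i ≤ ENNReal.ofReal (y i) :=
  (hy.toENN hP0 hy0).meanHittingTime_le hP0 i

/-- … and then `k_i^A < ∞`. [cite: Norris1997, §1.3 Thm 1.3.5] -/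
theorem IsMeanHitSystemSolution.meanHittingTime_ne_top (hP0 : ∀ x y, 0 ≤ P x y) {y : X → ℝ}
    (hy : IsMeanHitSystemSolution P A y) (hy0 : ∀ i, 0 ≤ y i) (i : X) :
    meanHittingTime P A i ≠ ∞ :=
  ne_top_of_le_ne_top ENNReal.ofReal_ne_top (hy.meanHittingTime_le hP0 hy0 i)

/-! ## Bounded case: the real limit solves (1.4) -/

/-- If the partial sums `E_i(H^A ∧ n)` are bounded (in `n`, for every `i`), their real limit
`sup_n E_i(H^A ∧ n)` solves the real system (1.4) (pass to the limit in the recursion).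
[cite: Norris1997, §1.3, proof of Thm 1.3.5] -/
theorem isMeanHitSystemSolution_ciSup (hP : IsRowStochastic P)
    (hbdd : ∀ i, BddAbove (Set.range fun n => meanHitWithin P A n i)) :
    IsMeanHitSystemSolution P A (fun i => ⨆ n, meanHitWithin P A n i) := by
  have ht : ∀ i, Tendsto (fun n => meanHitWithin P A n i) atTop (𝓝 (⨆ n, meanHitWithin P A n i)) :=
    fun i => tendsto_atTop_ciSup (meanHitWithin_mono hP.1 i) (hbdd i)
  refine ⟨fun i hi => ?_, fun i hi => ?_⟩
  · exact tendsto_nhds_unique (ht i) (by simp_rw [meanHitWithin_of_mem hi]; exact tendsto_const_nhds)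
  · have h1 : Tendsto (fun n => meanHitWithin P A (n + 1) i) atTop
        (𝓝 (⨆ n, meanHitWithin P A n i)) := (tendsto_add_atTop_iff_nat 1).mpr (ht i)
    have h2 : Tendsto (fun n => meanHitWithin P A (n + 1) i) atTop
        (𝓝 (1 + ∑ j, if j ∈ A then 0 else P i j * ⨆ n, meanHitWithin P A n j)) := by
      simp_rw [meanHitWithin_succ_of_not_mem' hi]
      refine tendsto_const_nhds.add (tendsto_finsetSum _ fun j _ => ?_)
      by_cases hj : j ∈ A
      · simp only [if_pos hj]
        exact tendsto_const_nhds
      · simp only [if_neg hj]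
        exact (ht j).const_mul (P i j)
    exact tendsto_nhds_unique h1 h2

/-- In the bounded case `k_i^A = ofReal (sup_n E_i(H^A ∧ n))`. [cite: Norris1997, §1.3 Thm 1.3.5] -/
theorem meanHittingTime_eq_ofReal_ciSup (hP : IsRowStochastic P) {i : X}
    (hbdd : BddAbove (Set.range fun n => meanHitWithin P A n i)) :
    meanHittingTime P A i = ENNReal.ofReal (⨆ n, meanHitWithin P A n i) := by
  have ht : Tendsto (fun n => ENNReal.ofReal (meanHitWithin P A n i)) atTop
      (𝓝 (ENNReal.ofReal (⨆ n, meanHitWithin P A n i))) :=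
    (ENNReal.continuous_ofReal.tendsto _).comp
      (tendsto_atTop_ciSup (meanHitWithin_mono hP.1 i) hbdd)
  exact tendsto_nhds_unique (tendsto_atTop_iSup (ofReal_meanHitWithin_mono hP.1 i)) ht

/-! ## Irreducible chains, one target: `k^{{a}}_x = E_x(τ_a)` is the tree's hitting-time solution -/

/-- For an IRREDUCIBLE chain and a single target `a`, with `H` the (unique) solution of the
first-step equations of `RandomTargetLemma.lean` (`H x a = E_x(τ_a)`): the mean hitting time of
`{a}` from `x` is finite and equals `H x a` — the truncated expectations `E_x(τ_a ∧ n)` increase to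
the solution of the linear system. [cite: Norris1997, §1.3 Thm 1.3.5] [cite: LevinPeres2017, §10.2,
proof of Lemma 10.1, eq. (10.3)] -/
theorem meanHittingTime_singleton_eq_ofReal [DecidableEq X] (hP : IsRowStochastic P)
    (hirr : IsIrreducible P) {H : X → X → ℝ} (hH : IsHittingTimeSolution P H) (a x : X) :
    meanHittingTime P ({a} : Set X) x = ENNReal.ofReal (H x a) := by
  -- `H · a` is a non-negative real solution of (1.4) for `A = {a}`
  have hsol : IsMeanHitSystemSolution P ({a} : Set X) (fun y => H y a) := by
    refine ⟨fun i hi => by show H i a = 0; rw [Set.mem_singleton_iff.mp hi, hH.diag],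
      fun i hi => ?_⟩
    have hia : i ≠ a := fun h => hi (h ▸ Set.mem_singleton a)
    show H i a = 1 + ∑ j, (if j ∈ ({a} : Set X) then 0 else P i j * H j a)
    rw [hH.off_diag hia]
    congr 1
    exact sum_congr rfl fun j _ => by
      by_cases hj : j = a
      · subst hj; simp [hH.diag]
      · simp [hj]
  have hy0 : ∀ i, 0 ≤ H i a := fun i => hH.nonneg hP i a
  -- hence the partial sums are bounded and their real limit `L` solves (1.4) as well
  have hbdd : ∀ i, BddAbove (Set.range fun n => meanHitWithin P ({a} : Set X) n i) :=
    fun i => ⟨H i a, by rintro _ ⟨n, rfl⟩; exact hsol.meanHitWithin_le hP.1 hy0 n i⟩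
  have hL := isMeanHitSystemSolution_ciSup hP hbdd
  -- two real solutions of the single-target system coincide on an irreducible chain
  have hu := eq_zero_of_harmonicOff hP hirr
    (u := fun i => (⨆ n, meanHitWithin P ({a} : Set X) n i) - H i a) (x := a)
    (by
      have hLa : (⨆ n, meanHitWithin P ({a} : Set X) n a) = 0 := hL.1 a (Set.mem_singleton a)
      show (⨆ n, meanHitWithin P ({a} : Set X) n a) - H a a = 0
      rw [hLa, hH.diag, sub_zero])
    (by
      intro b hb
      have hb' : b ∉ ({a} : Set X) := fun h => hb (Set.mem_singleton_iff.mp h)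
      have hLb : (⨆ n, meanHitWithin P ({a} : Set X) n b) =
          1 + ∑ j, (if j ∈ ({a} : Set X) then 0 else
            P b j * ⨆ n, meanHitWithin P ({a} : Set X) n j) := hL.2 b hb'
      have hsb : H b a = 1 + ∑ j, (if j ∈ ({a} : Set X) then 0 else P b j * H j a) := hsol.2 b hb'
      show (⨆ n, meanHitWithin P ({a} : Set X) n b) - H b a =
        ∑ y, P b y * ((⨆ n, meanHitWithin P ({a} : Set X) n y) - H y a)
      rw [hLb, hsb]
      simp only [mul_sub, sum_sub_distrib]
      have h3 : ∀ f : X → ℝ, f a = 0 →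
          ∑ j, (if j ∈ ({a} : Set X) then 0 else P b j * f j) = ∑ j, P b j * f j := by
        intro f hf
        exact sum_congr rfl fun j _ => by
          by_cases hj : j = a
          · subst hj; simp [hf]
          · simp [hj]
      rw [h3 (fun j => ⨆ n, meanHitWithin P ({a} : Set X) n j) (hL.1 a (Set.mem_singleton a)),
        h3 (fun j => H j a) (hH.diag a)]
      ring)
  have hx := congrFun hu x
  simp only [Pi.zero_apply, sub_eq_zero] at hx
  rw [meanHittingTime_eq_ofReal_ciSup hP (hbdd x), hx]

/-- In particular, on an irreducible chain every single-target mean hitting time is finite.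
[cite: Norris1997, §1.3 Thm 1.3.5] -/
theorem meanHittingTime_singleton_ne_top [DecidableEq X] (hP : IsRowStochastic P)
    (hirr : IsIrreducible P) (a x : X) : meanHittingTime P ({a} : Set X) x ≠ ∞ := by
  obtain ⟨H, hH⟩ := exists_isHittingTimeSolution hP hirr
  rw [meanHittingTime_singleton_eq_ofReal hP hirr hH a x]
  exact ENNReal.ofReal_ne_top

end Literature.Probability.MarkovChains
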